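import Literature.Computability.Cryptography.LWEHardness
import Literature.Computability.Complexity.ListFoldBricks
import Literature.Computability.Complexity.FoldBricks
import Literature.Computability.Complexity.PRelHierarchy
import HarnessLib

/-!
# Search ⇒ decision for LWE: the oracle machine of the zero-residual test

Sibling proof file of `Literature.Computability.Cryptography.LWEHardness`, written for the discharge
of the named fact `regev_search_to_decision` (Regev 2009, §1, p. 4: the easy direction of the
search/decision equivalence for LWE). It provides the probabilistic polynomial-time oracle
algorithm `M = s2dAlg` of that statement — an `OracleAlg Bool` in G01's transcript model whose
step function is polynomial-time (`s2dAlg_isPolyTime : s2dAlg.IsPolyTime encodingBoolBool`) — and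
its semantics on encoded LWE inputs (`s2dAlg_run`, `oracleLWEDistinguisher_s2dAlg`):

* round 1 (no answer yet): on input `⟨encodeLWESamples S, coins⟩`, `S : Fin (m+1) → ℤ_qⁿ × ℤ_q`,
  query the oracle on `encodeLWESamples (Fin.tail S)` (the last `m` samples; pure record surgery:
  drop one unary count symbol and the first framed item);
* round 2 (one answer `a`): output the bit `[(S 0).2 = ⟨(S 0).1, decodeSecret n q a⟩]`, where
  `decodeSecret` is EXACTLY the total decoder of `LWEHardness.lean` by which `Oracle.SolvesSearchLWE`
  judges the oracle (length check of the unary field, items read by Mathlib's `decodeNat` including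
  its reading of non-canonical numerals, junk secret `0` on a failed length check).

No machine is programmed: the step function is ONE total string function `s2dFn` assembled in the
tree's algebra of `FP` string functions (`comp_mem_FP`, `fanoutFn`, `iteFn`, record projections
`Brick.fstF/sndF/nthF/sndPow`, the arithmetic bricks `addFn`/`prodFn`/`remFn`, the numeral bricks
`canonF`/`lenBinF`/`eqValFn`/`isNilFn`, and the list fold `Brick.foldFn` of `ListFoldBricks.lean`,
whose semantics is total through the decoder `Brick.decNil`), and `OracleAlg.IsPolyTime` follows by
`PolyTimeComputable.of_encode` since `s2dFn` always outputs a valid tagged code (`s2dFn_shape`).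
The inner product `⟨a, s'⟩ mod q` is the fold `acc := (acc + aᵢ · decodeNat vᵢ) mod q` over the
items `vᵢ` of the answer, the `aᵢ` being consumed from a second list kept in the accumulator
(`stepF`, model `dotState`, value `dotState_cast`).

## References

* O. Regev, *On lattices, learning with errors, random linear codes, and cryptography*, J. ACM 56
  (2009), §1 (p. 4 of arXiv:2401.03703), §4.
* S. Arora, B. Barak, *Computational Complexity: A Modern Approach*, CUP 2009, §1.3 (polynomial
  time is closed under composition and bounded loops), §3.4 (oracle machines), §0.1 (pairing).
-/

noncomputable section

namespace Literature.Computability.Cryptography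

/-! All declarations of this file live in the grouping namespace `S2D` ("search to decision"),
whose short names (`inpF`, `stepF`, …) would otherwise collide with other machine files. -/
namespace S2D

open _root_.Computability Complexity Complexity.Brick LWE

/-! ### Codes of LWE data as records -/

section Codes

variable {n q m : ℕ}

/-- `foldr boolPair` is the list code `encList` of the mapped list. [folklore] -/
theorem foldr_boolPair_eq_encList {α : Type} (f : α → List Bool) (l : List α) :
    l.foldr (fun a acc => boolPair (f a) acc) [] = encList (l.map f) := by
  induction l with
  | nil => rfl
  | cons a l ih => rw [List.foldr_cons, ih, List.map_cons, encList_cons]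

/-- The code of a list of strings under the identity encoding: `⟨1^{|l|}, encList l⟩`. [folklore] -/
theorem listBool_encode_eq (l : List (List Bool)) :
    (encodingList Bool).listBool.encode l = boolPair (unaryEncodeNat l.length) (encList l) := by
  change boolPair (unaryEncodeNat l.length) (l.foldr (fun a acc => boolPair ((encodingList Bool).encode a) acc) []) = _
  rw [foldr_boolPair_eq_encList]
  congr 1
  rw [show ((encodingList Bool).encode : List Bool → List Bool) = id from rfl, List.map_id]

/-- The code of one LWE sample `(a, b) ∈ ℤ_qⁿ × ℤ_q`: `⟨⟨1ⁿ, encList (bin aᵢ)ᵢ⟩, bin b⟩`.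
[Regev 2009, §2; Arora–Barak 2009, §0.1] [folklore] -/
def sampleCode (x : (Fin n → ZMod q) × ZMod q) : List Bool :=
  boolPair (boolPair (unaryEncodeNat n) (encList (List.ofFn fun i => encodeNat (x.1 i).val)))
    (encodeNat x.2.val)

/-- **`encodeLWESamples` as a record**: `⟨bin n, ⟨bin q, ⟨1ᵐ, encList (sample codes)⟩⟩⟩`. [folklore] -/
theorem encodeLWESamples_eq (S : Fin m → (Fin n → ZMod q) × ZMod q) :
    encodeLWESamples S = boolPair (encodeNat n) (boolPair (encodeNat q)
      (boolPair (unaryEncodeNat m) (encList (List.ofFn fun j => sampleCode (S j))))) := by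
  unfold encodeLWESamples
  congr 2
  change boolPair (unaryEncodeNat (List.ofFn _).length) ((List.ofFn _).foldr _ []) = _
  rw [List.length_ofFn, foldr_boolPair_eq_encList, List.map_ofFn]
  congr 2
  rw [List.ofFn_inj]
  funext j
  simp only [Function.comp_apply, sampleCode]
  change boolPair (boolPair (unaryEncodeNat (List.ofFn _).length) ((List.ofFn _).foldr _ [])) _ = _
  rw [List.length_ofFn, foldr_boolPair_eq_encList, List.map_ofFn]
  rfl

/-- The sample list of `m + 1` samples: first sample, then the tail. [folklore] -/
theorem encList_ofFn_succ (S : Fin (m + 1) → (Fin n → ZMod q) × ZMod q) :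
    encList (List.ofFn fun j => sampleCode (S j)) =
      boolPair (sampleCode (S 0)) (encList (List.ofFn fun j => sampleCode (Fin.tail S j))) := by
  rw [List.ofFn_succ, encList_cons]
  rfl

end Codes

/-! ### The total decoder of secrets, spelled out -/

section Decoder

variable {n q : ℕ}

/-- The naturals read by `listBoolDecode encodingNatBool k`: `k` items split off by `boolUnpair`,
each read by `decodeNat`. [folklore] -/
def natItems : ℕ → List Bool → List ℕ
  | 0, _ => []
  | k + 1, w => decodeNat (fstF w) :: natItems k (sndF w)

/-- `listBoolDecode` over the (total) binary decoder never fails. [folklore] -/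
theorem listBoolDecode_natBool (k : ℕ) (w : List Bool) :
    listBoolDecode encodingNatBool k w = some (natItems k w) := by
  induction k generalizing w with
  | zero => rfl
  | succ k ih =>
    simp only [listBoolDecode, natItems, ih]
    rfl

/-- `natItems k w` has `k` items. [folklore] -/
@[simp] theorem length_natItems : ∀ (k : ℕ) (w : List Bool), (natItems k w).length = k
  | 0, _ => rfl
  | k + 1, w => by rw [natItems, List.length_cons, length_natItems k]

/-- Item `i` of `natItems k w` is `decodeNat (fstF (sndF^[i] w))`. [folklore] -/
theorem natItems_getElem : ∀ (k : ℕ) (w : List Bool) (i : ℕ) (hi : i < (natItems k w).length),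
    (natItems k w)[i] = decodeNat (fstF (sndF^[i] w))
  | 0, _, i, hi => by simp at hi
  | k + 1, w, 0, _ => by simp [natItems]
  | k + 1, w, i + 1, hi => by
    simp only [natItems, List.getElem_cons_succ]
    rw [natItems_getElem k (sndF w) i (by simpa [natItems] using hi), Function.iterate_succ_apply]

/-- The vector decoder over the binary decoder, spelled out: length check of the unary field, then
the items. [folklore] -/
theorem encodingFinVec_natBool_decode (n : ℕ) (u : List Bool) :
    (encodingFinVec encodingNatBool n).decode u =
      if (fstF u).length = n then some (fun i : Fin n => decodeNat (fstF (sndF^[(i : ℕ)] (sndF u))))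
      else none := by
  change (listBoolDecode encodingNatBool (unaryDecodeNat (boolUnpair u).1) (boolUnpair u).2).bind _ = _
  rw [listBoolDecode_natBool, Option.bind_some]
  change (if h : (natItems (fstF u).length (sndF u)).length = n then _ else none) = _
  by_cases h : (fstF u).length = n
  · rw [dif_pos (by simpa using h), if_pos h]
    congr 1
    funext i
    simp only [List.get_eq_getElem, Fin.val_cast]
    exact natItems_getElem _ _ _ _
  · rw [dif_neg (by simpa using h), if_neg h]

/-- **`decodeSecret` spelled out**: with `u` the first pair component of the answer,
`decodeSecret n q a = (decodeNat (item i of sndF u) mod q)ᵢ` if the unary field of `u` has length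
`n`, and the junk secret `0` otherwise. [folklore] -/
theorem decodeSecret_eq (n q : ℕ) (a : List Bool) :
    decodeSecret n q a =
      if (fstF (fstF a)).length = n then
        fun i : Fin n => ((decodeNat (fstF (sndF^[(i : ℕ)] (sndF (fstF a)))) : ℕ) : ZMod q)
      else 0 := by
  unfold decodeSecret
  rw [show (boolUnpair a).1 = fstF a from rfl, encodingFinVec_natBool_decode]
  by_cases h : (fstF (fstF a)).length = n
  · simp only [if_pos h]
  · simp only [if_neg h]

end Decoder

/-! ### The step function as an `FP` string function -/

section StringLevel

/-- The LWE input `x` inside the step argument `W = ⟨⟨x, coins⟩, answers⟩`. [folklore] -/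
def inpF : List Bool → List Bool := fstF ∘ fstF

/-- Header `bin n`. [folklore] -/
def hdrNF : List Bool → List Bool := nthF 0 ∘ inpF

/-- Header `bin q`. [folklore] -/
def hdrQF : List Bool → List Bool := nthF 1 ∘ inpF

/-- The unary sample count. [folklore] -/
def cntF : List Bool → List Bool := nthF 2 ∘ inpF

/-- The list code of the samples. [folklore] -/
def itemsF : List Bool → List Bool := sndPow 2 ∘ inpF

/-- The first recorded answer. [folklore] -/
def ansF : List Bool → List Bool := fstF ∘ sndF ∘ sndF

/-- "No answer recorded yet" (the unary length field of the answer list is empty). [folklore] -/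
def noAnsF : List Bool → List Bool := isNilFn ∘ fstF ∘ sndF

/-- **The query**: the samples without the first one (one count symbol and the first framed item
dropped). [Regev 2009, §1] [folklore] -/
def queryF : List Bool → List Bool :=
  fanoutFn hdrNF (fanoutFn hdrQF (fanoutFn (List.tail ∘ cntF) (sndF ∘ itemsF)))

/-- The unary length field of the answer's vector code. [folklore] -/
def secCntF : List Bool → List Bool := fstF ∘ fstF ∘ ansF

/-- The list body of the answer's vector code. [folklore] -/
def secBodyF : List Bool → List Bool := sndF ∘ fstF ∘ ansF

/-- The code of the first (fresh) sample. [folklore] -/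
def item0F : List Bool → List Bool := fstF ∘ itemsF

/-- The list code of the entries `aᵢ` of the fresh sample. [folklore] -/
def aItemsF : List Bool → List Bool := sndF ∘ fstF ∘ item0F

/-- The numeral `bin b` of the fresh sample. [folklore] -/
def bF : List Bool → List Bool := sndF ∘ item0F

/-- The length check `[|unary field of the answer| = n]`. [folklore] -/
def condF : List Bool → List Bool := eqValFn ∘ fanoutFn (lenBinF ∘ secCntF) hdrNF

/-- One step of the inner-product fold, on `⟨ctx, ⟨v, ⟨aRest, sum⟩⟩⟩` (`ctx = ⟨W, body⟩`):
`⟨tail aRest, bin ((⟦sum⟧ + ⟦head aRest⟧ · decodeNat v) mod q)⟩`. [folklore] -/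
def stepF : List Bool → List Bool :=
  fanoutFn (sndF ∘ nthF 2)
    (remFn ∘ fanoutFn
      (addFn ∘ fanoutFn (sndPow 2) (prodFn ∘ fanoutFn (fstF ∘ nthF 2) (canonF ∘ nthF 1)))
      (hdrQF ∘ fstF ∘ fstF))

/-- The initial accumulator `⟨encList (bin aᵢ)ᵢ, bin 0⟩` on the fold context `⟨W, body⟩`. [folklore] -/
def iniF : List Bool → List Bool := fanoutFn (aItemsF ∘ fstF) (fun _ => [])

/-- The numeral of `⟨a, s'⟩ mod q` (`s'` read off the answer). [folklore] -/
def dotF : List Bool → List Bool := sndF ∘ foldFn stepF iniF ∘ fanoutFn id secBodyF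

/-- **The test bit** `[b = ⟨a, s'⟩ mod q]`, with the junk secret `0` when the length check fails.
[Regev 2009, §1] [folklore] -/
def testF : List Bool → List Bool :=
  iteFn condF (eqValFn ∘ fanoutFn dotF bF) (isNilFn ∘ bF)

/-- **The step function**: query (tag `0`) while no answer is recorded, output the test bit
(tag `1`) afterwards. [Arora–Barak 2009, §3.4; Regev 2009, §1] [folklore] -/
def s2dFn : List Bool → List Bool :=
  iteFn noAnsF (List.cons false ∘ queryF) (List.cons true ∘ testF)

/-! #### Membership in `FP` -/

/-- `inpF ∈ FP`. [folklore] -/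
theorem inpF_mem_FP : inpF ∈ FP := comp_mem_FP fstF_mem_FP fstF_mem_FP

/-- `hdrNF ∈ FP`. [folklore] -/
theorem hdrNF_mem_FP : hdrNF ∈ FP := comp_mem_FP (nthF_mem_FP 0) inpF_mem_FP

/-- `hdrQF ∈ FP`. [folklore] -/
theorem hdrQF_mem_FP : hdrQF ∈ FP := comp_mem_FP (nthF_mem_FP 1) inpF_mem_FP

/-- `cntF ∈ FP`. [folklore] -/
theorem cntF_mem_FP : cntF ∈ FP := comp_mem_FP (nthF_mem_FP 2) inpF_mem_FP

/-- `itemsF ∈ FP`. [folklore] -/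
theorem itemsF_mem_FP : itemsF ∈ FP := comp_mem_FP (sndPow_mem_FP 2) inpF_mem_FP

/-- `ansF ∈ FP`. [folklore] -/
theorem ansF_mem_FP : ansF ∈ FP := comp_mem_FP fstF_mem_FP (comp_mem_FP sndF_mem_FP sndF_mem_FP)

/-- `noAnsF ∈ FP`. [folklore] -/
theorem noAnsF_mem_FP : noAnsF ∈ FP := comp_mem_FP isNilFn_mem_FP (comp_mem_FP fstF_mem_FP sndF_mem_FP)

/-- `queryF ∈ FP`. [cite: AroraBarak2009, §1.3] -/
theorem queryF_mem_FP : queryF ∈ FP :=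
  fanoutFn_mem_FP hdrNF_mem_FP (fanoutFn_mem_FP hdrQF_mem_FP
    (fanoutFn_mem_FP (comp_mem_FP PRelSigma.tail_mem_FP cntF_mem_FP) (comp_mem_FP sndF_mem_FP itemsF_mem_FP)))

/-- `secCntF ∈ FP`. [folklore] -/
theorem secCntF_mem_FP : secCntF ∈ FP := comp_mem_FP fstF_mem_FP (comp_mem_FP fstF_mem_FP ansF_mem_FP)

/-- `secBodyF ∈ FP`. [folklore] -/
theorem secBodyF_mem_FP : secBodyF ∈ FP := comp_mem_FP sndF_mem_FP (comp_mem_FP fstF_mem_FP ansF_mem_FP)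

/-- `item0F ∈ FP`. [folklore] -/
theorem item0F_mem_FP : item0F ∈ FP := comp_mem_FP fstF_mem_FP itemsF_mem_FP

/-- `aItemsF ∈ FP`. [folklore] -/
theorem aItemsF_mem_FP : aItemsF ∈ FP := comp_mem_FP sndF_mem_FP (comp_mem_FP fstF_mem_FP item0F_mem_FP)

/-- `bF ∈ FP`. [folklore] -/
theorem bF_mem_FP : bF ∈ FP := comp_mem_FP sndF_mem_FP item0F_mem_FP

/-- `condF ∈ FP`. [folklore] -/
theorem condF_mem_FP : condF ∈ FP :=
  comp_mem_FP eqValFn_mem_FP (fanoutFn_mem_FP (comp_mem_FP lenBinF_mem_FP secCntF_mem_FP) hdrNF_mem_FP)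

/-- `stepF ∈ FP`. [folklore] -/
theorem stepF_mem_FP : stepF ∈ FP :=
  fanoutFn_mem_FP (comp_mem_FP sndF_mem_FP (nthF_mem_FP 2))
    (comp_mem_FP remFn_mem_FP (fanoutFn_mem_FP
      (comp_mem_FP addFn_mem_FP (fanoutFn_mem_FP (sndPow_mem_FP 2)
        (comp_mem_FP prodFn_mem_FP (fanoutFn_mem_FP (comp_mem_FP fstF_mem_FP (nthF_mem_FP 2))
          (comp_mem_FP canonF_mem_FP (nthF_mem_FP 1))))))
      (comp_mem_FP hdrQF_mem_FP (comp_mem_FP fstF_mem_FP fstF_mem_FP))))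

/-- `iniF ∈ FP`. [folklore] -/
theorem iniF_mem_FP : iniF ∈ FP := fanoutFn_mem_FP (comp_mem_FP aItemsF_mem_FP fstF_mem_FP) (const_mem_FP _)

/-- The remainder brick never lengthens the canonical dividend: `|remFn ⟨a, b⟩| ≤ |encodeNat ⟦a⟧|`.
[folklore] -/
theorem length_remFn_le (w : List Bool) : (remFn w).length ≤ (fstF w).length := by
  have h : remFn w = encodeNat (bitsToNat (fstF w) % bitsToNat (sndF w)) := rfl
  rw [h]
  exact (length_encodeNat_mono (Nat.mod_le _ _)).trans (length_encodeNat_bitsToNat_le _)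

/-- **Growth of the fold step** (total): `|stepF v| ≤ |acc| + 4|v| + 4(|ctx| + 1)`. [folklore] -/
theorem foldGrowth_stepF : FoldGrowth 4 stepF := by
  intro v
  have hacc := length_fstF_sndF_le (sndF (sndF v))
  have haRest := length_fstF_sndF_le (fstF (sndF (sndF v)))
  have hrem := length_remFn_le (boolPair (addFn (boolPair (sndPow 2 v) (prodFn (boolPair
    (fstF (nthF 2 v)) (canonF (nthF 1 v)))))) (hdrQF (fstF (fstF v))))
  rw [fstF_boolPair] at hrem
  have hadd := length_encodeNat_add_le (sndPow 2 v) (prodFn (boolPair (fstF (nthF 2 v)) (canonF (nthF 1 v))))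
  have hprod := length_encodeNat_mul_le (fstF (nthF 2 v)) (canonF (nthF 1 v))
  have hcanon := length_canonF_le (nthF 1 v)
  simp only [stepF, fanoutFn_apply, Function.comp_apply, length_boolPair, addFn_boolPair,
    prodFn_boolPair] at hrem hadd hprod ⊢
  have e1 : nthF 2 v = fstF (sndF (sndF v)) := rfl
  have e2 : sndPow 2 v = sndF (sndF (sndF v)) := rfl
  have e3 : nthF 1 v = fstF (sndF v) := rfl
  simp only [e1, e2, e3] at hrem hadd hprod hcanon ⊢
  omega

/-- `dotF ∈ FP`. [cite: AroraBarak2009, §1.3 (bounded loops)] -/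
theorem dotF_mem_FP : dotF ∈ FP :=
  comp_mem_FP sndF_mem_FP (comp_mem_FP (foldFn_mem_FP stepF_mem_FP iniF_mem_FP foldGrowth_stepF)
    (fanoutFn_mem_FP OracleCompose.id_mem_FP secBodyF_mem_FP))

/-- `testF ∈ FP`. [folklore] -/
theorem testF_mem_FP : testF ∈ FP :=
  iteFn_mem_FP condF_mem_FP (comp_mem_FP eqValFn_mem_FP (fanoutFn_mem_FP dotF_mem_FP bF_mem_FP))
    (comp_mem_FP isNilFn_mem_FP bF_mem_FP)

/-- **`s2dFn ∈ FP`.** [cite: AroraBarak2009, §1.3] -/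
theorem s2dFn_mem_FP : s2dFn ∈ FP :=
  iteFn_mem_FP noAnsF_mem_FP (comp_mem_FP (cons_mem_FP false) queryF_mem_FP)
    (comp_mem_FP (cons_mem_FP true) testF_mem_FP)

/-! #### Shape of the output -/

/-- `condF` is one-bit. [folklore] -/
theorem oneBit_condF : OneBit condF := oneBit_eqValFn.comp _

/-- `testF` is one-bit. [folklore] -/
theorem oneBit_testF : OneBit testF :=
  oneBit_condF.ite (oneBit_eqValFn.comp _) (oneBit_isNilFn.comp _)

/-- On every input, `s2dFn` is a valid tagged code: a query `0 y` or an output `1 b`. [folklore] -/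
theorem s2dFn_eq (w : List Bool) :
    s2dFn w = if noAnsF w = [true] then false :: queryF w else true :: testF w :=
  iteFn_of_oneBit (oneBit_isNilFn.comp _) _ _ w

end StringLevel

/-! ### Semantics on encoded LWE inputs -/

section Semantics

variable {n q m : ℕ}

/-- The step argument on an LWE input with coins `r` and answers `ans`. [folklore] -/
def stepArg (S : Fin (m + 1) → (Fin n → ZMod q) × ZMod q) (r : List Bool) (ans : List (List Bool)) :
    List Bool :=
  boolPair (boolPair (encodeLWESamples S) r) ((encodingList Bool).listBool.encode ans)

/-- `inpF` reads the LWE input back. [folklore] -/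
theorem inpF_stepArg (S : Fin (m + 1) → (Fin n → ZMod q) × ZMod q) (r : List Bool) (ans : List (List Bool)) :
    inpF (stepArg S r ans) = boolPair (encodeNat n) (boolPair (encodeNat q)
      (boolPair (unaryEncodeNat (m + 1)) (boolPair (sampleCode (S 0))
        (encList (List.ofFn fun j => sampleCode (Fin.tail S j)))))) := by
  simp only [inpF, stepArg, Function.comp_apply, fstF_boolPair, encodeLWESamples_eq, encList_ofFn_succ]

/-- `noAnsF` tests whether an answer has been recorded. [folklore] -/
theorem noAnsF_stepArg (S : Fin (m + 1) → (Fin n → ZMod q) × ZMod q) (r : List Bool) (ans : List (List Bool)) :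
    noAnsF (stepArg S r ans) = [decide (ans = [])] := by
  simp only [noAnsF, stepArg, Function.comp_apply, listBool_encode_eq, sndF_boolPair, fstF_boolPair, isNilFn]
  cases ans <;> simp [unaryEncodeNat]

/-- **Round 1: the query is the code of the last `m` samples.** [Regev 2009, §1] [folklore] -/
theorem queryF_stepArg (S : Fin (m + 1) → (Fin n → ZMod q) × ZMod q) (r : List Bool) (ans : List (List Bool)) :
    queryF (stepArg S r ans) = encodeLWESamples (Fin.tail S) := by
  simp only [queryF, hdrNF, hdrQF, cntF, itemsF, fanoutFn_apply, Function.comp_apply, inpF_stepArg,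
    nthF_zero_boolPair, nthF_succ_boolPair, sndPow_succ_boolPair, sndPow_zero_boolPair, sndF_boolPair,
    encodeLWESamples_eq]
  rfl

/-- `ansF` reads the first answer. [folklore] -/
theorem ansF_stepArg (S : Fin (m + 1) → (Fin n → ZMod q) × ZMod q) (r : List Bool) (a : List Bool)
    (rest : List (List Bool)) : ansF (stepArg S r (a :: rest)) = a := by
  simp only [ansF, stepArg, Function.comp_apply, listBool_encode_eq, sndF_boolPair, encList_cons, fstF_boolPair]

/-- `hdrNF` reads `bin n`. [folklore] -/
theorem hdrNF_stepArg (S : Fin (m + 1) → (Fin n → ZMod q) × ZMod q) (r : List Bool) (ans : List (List Bool)) :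
    hdrNF (stepArg S r ans) = encodeNat n := by
  simp only [hdrNF, Function.comp_apply, inpF_stepArg, nthF_zero_boolPair]

/-- `hdrQF` reads `bin q`. [folklore] -/
theorem hdrQF_stepArg (S : Fin (m + 1) → (Fin n → ZMod q) × ZMod q) (r : List Bool) (ans : List (List Bool)) :
    hdrQF (stepArg S r ans) = encodeNat q := by
  simp only [hdrQF, Function.comp_apply, inpF_stepArg, nthF_succ_boolPair, nthF_zero_boolPair]

/-- `item0F` reads the code of the fresh sample. [folklore] -/
theorem item0F_stepArg (S : Fin (m + 1) → (Fin n → ZMod q) × ZMod q) (r : List Bool) (ans : List (List Bool)) :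
    item0F (stepArg S r ans) = sampleCode (S 0) := by
  simp only [item0F, itemsF, Function.comp_apply, inpF_stepArg, sndPow_succ_boolPair, sndPow_zero_boolPair,
    fstF_boolPair]

/-- `aItemsF` reads the list code of the `aᵢ`. [folklore] -/
theorem aItemsF_stepArg (S : Fin (m + 1) → (Fin n → ZMod q) × ZMod q) (r : List Bool) (ans : List (List Bool)) :
    aItemsF (stepArg S r ans) = encList (List.ofFn fun i => encodeNat ((S 0).1 i).val) := by
  simp only [aItemsF, Function.comp_apply, item0F_stepArg, sampleCode, fstF_boolPair, sndF_boolPair]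

/-- `bF` reads `bin b`. [folklore] -/
theorem bF_stepArg (S : Fin (m + 1) → (Fin n → ZMod q) × ZMod q) (r : List Bool) (ans : List (List Bool)) :
    bF (stepArg S r ans) = encodeNat (S 0).2.val := by
  simp only [bF, Function.comp_apply, item0F_stepArg, sampleCode, sndF_boolPair]

/-! #### The inner-product fold -/

/-- The arithmetic model of the fold: consume the `aᵢ` from a list, accumulate
`(sum + aᵢ · decodeNat vᵢ) mod q` over the items `vᵢ`. [folklore] -/
def dotState (q : ℕ) (as : List ℕ) (vs : List (List Bool)) (s₀ : ℕ) : List ℕ × ℕ :=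
  vs.foldl (fun p v => (p.1.tail, (p.2 + p.1.headD 0 * decodeNat v) % q)) (as, s₀)

/-- The fold step on a modelled accumulator. [folklore] -/
theorem stepF_model (ctx : List Bool) (hq : hdrQF (fstF ctx) = encodeNat q) (v : List Bool) (as : List ℕ) (s : ℕ) :
    stepF (boolPair ctx (boolPair v (boolPair (encList (as.map encodeNat)) (encodeNat s)))) =
      boolPair (encList (as.tail.map encodeNat)) (encodeNat ((s + as.headD 0 * decodeNat v) % q)) := by
  have hnil : fstF ([] : List Bool) = [] := rfl
  have hnil' : sndF ([] : List Bool) = [] := rfl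
  simp only [stepF, fanoutFn_apply, Function.comp_apply, nthF_succ_boolPair, nthF_zero_boolPair,
    sndPow_succ_boolPair, sndPow_zero_boolPair, fstF_boolPair, hq, remFn_boolPair,
    addFn_boolPair, prodFn_boolPair, bitsToNat_encodeNat, bitsToNat_canonF]
  cases as with
  | nil => simp [hnil, hnil']
  | cons a as => simp [encList_cons]

/-- **The fold computes the model.** [folklore] -/
theorem foldl_stepF (ctx : List Bool) (hq : hdrQF (fstF ctx) = encodeNat q) :
    ∀ (vs : List (List Bool)) (as : List ℕ) (s₀ : ℕ),
      vs.foldl (fun acc v => stepF (boolPair ctx (boolPair v acc)))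
          (boolPair (encList (as.map encodeNat)) (encodeNat s₀)) =
        boolPair (encList ((dotState q as vs s₀).1.map encodeNat)) (encodeNat (dotState q as vs s₀).2)
  | [], as, s₀ => rfl
  | v :: vs, as, s₀ => by
    rw [List.foldl_cons, stepF_model ctx hq, foldl_stepF ctx hq vs]
    rfl

/-- With no `aᵢ` left the sum only gets reduced: its residue is unchanged. [folklore] -/
theorem dotState_nil_cast (q : ℕ) : ∀ (vs : List (List Bool)) (s₀ : ℕ),
    (((dotState q [] vs s₀).2 : ℕ) : ZMod q) = s₀
  | [], s₀ => rfl
  | v :: vs, s₀ => by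
    rw [dotState, List.foldl_cons, ← dotState]
    simp only [List.tail_nil, List.headD_nil, zero_mul, add_zero]
    rw [dotState_nil_cast q vs, ZMod.natCast_mod]

/-- The specification of the inner product against the items of a string `w` read by
`fstF`/`sndF`. [folklore] -/
def dotSpec : List ℕ → List Bool → ℕ
  | [], _ => 0
  | a :: as, w => a * decodeNat (fstF w) + dotSpec as (sndF w)

/-- `decodeNat` of the empty numeral is `0`. [folklore] -/
theorem decodeNat_nil : decodeNat [] = 0 := by decide

/-- Against the empty string every item reads `0`. [folklore] -/
theorem dotSpec_nil_right : ∀ as : List ℕ, dotSpec as [] = 0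
  | [] => rfl
  | a :: as => by
    change a * decodeNat [] + dotSpec as [] = 0
    rw [dotSpec_nil_right as, decodeNat_nil, mul_zero]

/-- **Value of the model**: the residue of `s₀ + Σᵢ aᵢ · decodeNat (item i of w)`, the items being
those of the total decoder `decNil`. [folklore] -/
theorem dotState_cast (q : ℕ) : ∀ (as : List ℕ) (w : List Bool) (s₀ : ℕ),
    (((dotState q as (decNil w) s₀).2 : ℕ) : ZMod q) = s₀ + dotSpec as w
  | [], w, s₀ => by rw [dotState_nil_cast, dotSpec, Nat.cast_zero, add_zero]
  | a :: as, w, s₀ => by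
    by_cases hw : w = []
    · subst hw
      rw [decNil_nil, dotSpec_nil_right]
      simp [dotState]
    · rw [decNil_of_ne_nil hw, dotState, List.foldl_cons, ← dotState, dotSpec]
      simp only [List.tail_cons, List.headD_cons]
      rw [dotState_cast q as (sndF w)]
      push_cast
      rw [ZMod.natCast_mod]
      push_cast
      ring

/-- The specification on the list of the `aᵢ` is the inner product with the decoded items.
[folklore] -/
theorem dotSpec_ofFn : ∀ (n : ℕ) (f : Fin n → ℕ) (w : List Bool),
    dotSpec (List.ofFn f) w = ∑ i : Fin n, f i * decodeNat (fstF (sndF^[(i : ℕ)] w))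
  | 0, f, w => by simp [dotSpec]
  | n + 1, f, w => by
    rw [List.ofFn_succ, dotSpec, Fin.sum_univ_succ, dotSpec_ofFn n]
    simp only [Fin.val_zero, Function.iterate_zero, id_eq, Fin.val_succ, Function.iterate_succ_apply]

/-- The accumulated value is a residue (or the initial `0`). [folklore] -/
theorem dotState_snd_lt (hq : 0 < q) : ∀ (vs : List (List Bool)) (as : List ℕ),
    (dotState q as vs 0).2 < q
  | [], as => hq
  | v :: vs, as => by
    suffices h : ∀ (ws : List (List Bool)) (bs : List ℕ) (s : ℕ), s < q → (dotState q bs ws s).2 < q from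
      h (v :: vs) as 0 hq
    intro ws
    induction ws with
    | nil => intro bs s hs; exact hs
    | cons w ws ih =>
      intro bs s _
      rw [dotState, List.foldl_cons, ← dotState]
      exact ih _ _ (Nat.mod_lt _ hq)

/-- **`dotF` computes `⟨a, s'⟩ mod q`** where `s'ᵢ = decodeNat (item i of the answer body)`.
[folklore] -/
theorem dotF_stepArg (S : Fin (m + 1) → (Fin n → ZMod q) × ZMod q) (r : List Bool) (a : List Bool)
    (rest : List (List Bool)) :
    dotF (stepArg S r (a :: rest)) =
      encodeNat (dotState q (List.ofFn fun i => ((S 0).1 i).val) (decNil (sndF (fstF a))) 0).2 := by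
  have hctx : hdrQF (fstF (boolPair (stepArg S r (a :: rest)) (sndF (fstF a)))) = encodeNat q := by
    rw [fstF_boolPair, hdrQF_stepArg]
  simp only [dotF, Function.comp_apply, fanoutFn_apply, id, foldFn_boolPair, secBodyF, ansF_stepArg]
  have hini : iniF (boolPair (stepArg S r (a :: rest)) (sndF (fstF a))) =
      boolPair (encList ((List.ofFn fun i => ((S 0).1 i).val).map encodeNat)) (encodeNat 0) := by
    simp only [iniF, fanoutFn_apply, Function.comp_apply, fstF_boolPair, aItemsF_stepArg, List.map_ofFn]
    congr 1
  rw [hini, foldl_stepF _ hctx, sndF_boolPair]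

/-- **Round 2: the test bit is `[b = ⟨a, decodeSecret n q answer⟩]`.** [Regev 2009, §1] [folklore] -/
theorem testF_stepArg [NeZero q] (S : Fin (m + 1) → (Fin n → ZMod q) × ZMod q) (r : List Bool)
    (a : List Bool) (rest : List (List Bool)) :
    testF (stepArg S r (a :: rest)) = [decide ((S 0).2 = (S 0).1 ⬝ᵥ decodeSecret n q a)] := by
  have hq : 0 < q := Nat.pos_of_ne_zero (NeZero.ne q)
  have hcond : condF (stepArg S r (a :: rest)) = [decide ((fstF (fstF a)).length = n)] := by
    simp only [condF, Function.comp_apply, fanoutFn_apply, eqValFn_boolPair, lenBinF_apply, secCntF,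
      ansF_stepArg, hdrNF_stepArg, bitsToNat_encodeNat]
  rw [testF, iteFn_apply hcond, decodeSecret_eq]
  by_cases hlen : (fstF (fstF a)).length = n
  · simp only [hlen, decide_true, ↓reduceIte, Function.comp_apply, fanoutFn_apply, eqValFn_boolPair,
      dotF_stepArg, bF_stepArg, bitsToNat_encodeNat]
    congr 1
    set D := (dotState q (List.ofFn fun i => ((S 0).1 i).val) (decNil (sndF (fstF a))) 0).2 with hD
    have hDlt : D < q := dotState_snd_lt hq _ _
    have hcast : ((D : ℕ) : ZMod q) = (S 0).1 ⬝ᵥ fun i : Fin n =>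
        ((decodeNat (fstF (sndF^[(i : ℕ)] (sndF (fstF a)))) : ℕ) : ZMod q) := by
      rw [hD, dotState_cast, Nat.cast_zero, zero_add, dotSpec_ofFn, dotProduct]
      push_cast
      refine Finset.sum_congr rfl fun i _ => ?_
      rw [ZMod.natCast_zmod_val]
    rw [decide_eq_decide]
    constructor
    · intro h
      rw [← hcast, h, ZMod.natCast_zmod_val]
    · intro h
      have h' : ((D : ℕ) : ZMod q) = (((S 0).2.val : ℕ) : ZMod q) := by rw [hcast, ← h, ZMod.natCast_zmod_val]
      rw [ZMod.natCast_eq_natCast_iff', Nat.mod_eq_of_lt hDlt, Nat.mod_eq_of_lt (ZMod.val_lt _)] at h'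
      exact h'
  · simp only [hlen, decide_false, Bool.false_eq_true, ↓reduceIte, Function.comp_apply, bF_stepArg, isNilFn,
      dotProduct_zero]
    congr 1
    rw [decide_eq_decide]
    constructor
    · intro h
      have h1 : (S 0).2.val = 0 := by
        have := congrArg bitsToNat h
        simpa using this
      exact (ZMod.val_eq_zero _).1 h1
    · intro h
      rw [h, ZMod.val_zero]
      decide

/-- **The step function on encoded inputs.** [folklore] -/
theorem s2dFn_stepArg_nil (S : Fin (m + 1) → (Fin n → ZMod q) × ZMod q) (r : List Bool) :
    s2dFn (stepArg S r []) = false :: encodeLWESamples (Fin.tail S) := by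
  rw [s2dFn_eq, noAnsF_stepArg, queryF_stepArg]
  simp

/-- **The step function on encoded inputs.** [folklore] -/
theorem s2dFn_stepArg_cons [NeZero q] (S : Fin (m + 1) → (Fin n → ZMod q) × ZMod q) (r : List Bool)
    (a : List Bool) (rest : List (List Bool)) :
    s2dFn (stepArg S r (a :: rest)) = [true, decide ((S 0).2 = (S 0).1 ⬝ᵥ decodeSecret n q a)] := by
  rw [s2dFn_eq, noAnsF_stepArg, testF_stepArg]
  simp

end Semantics

/-! ### The oracle algorithm -/

section Algorithm

/-- Reading a tagged code back: `0 y ↦ query y`, `1 b ↦ output b` (junk `output 0`). [folklore] -/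
def s2dDecode : List Bool → List Bool ⊕ Bool
  | false :: w => Sum.inl w
  | true :: b :: _ => Sum.inr b
  | _ => Sum.inr false

/-- **The search-to-decision oracle algorithm** `M`: its step function is `s2dFn` on the coded
(input, answers), read back as a query or an output bit. [Regev 2009, §1; Arora–Barak 2009, §3.4]
[cite: Regev2009, §1 p. 4] -/
def s2dAlg : OracleAlg Bool where
  step x ans := s2dDecode (s2dFn (boolPair x ((encodingList Bool).listBool.encode ans)))

/-- The tagged code of the step result is `s2dFn` itself (its output is always a valid code).
[folklore] -/
theorem encode_s2dAlg_step (x : List Bool) (ans : List (List Bool)) :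
    ((encodingList Bool).sumBool encodingBoolBool).encode (s2dAlg.step x ans) =
      s2dFn (boolPair x ((encodingList Bool).listBool.encode ans)) := by
  change ((encodingList Bool).sumBool encodingBoolBool).encode (s2dDecode _) = _
  rw [s2dFn_eq]
  split_ifs with h
  · rfl
  · obtain ⟨b, hb⟩ := oneBit_testF (boolPair x ((encodingList Bool).listBool.encode ans))
    rw [hb]
    rfl

/-- **`M` is polynomial-time** (its step function is the `FP` function `s2dFn` up to the codings).
[Arora–Barak 2009, §1.3, §3.4] [cite: AroraBarak2009, §3.4] -/
theorem s2dAlg_isPolyTime : s2dAlg.IsPolyTime encodingBoolBool :=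
  PolyTimeComputable.of_encode (F := s2dFn) s2dFn_mem_FP
    (g := fun p : List Bool × List (List Bool) => boolPair p.1 ((encodingList Bool).listBool.encode p.2))
    (fun _ => rfl) fun p => by
      obtain ⟨x, ans⟩ := p
      exact (encode_s2dAlg_step x ans).symm

variable {n q m : ℕ}

/-- **The run of `M`**: one query (the last `m` samples), then the test bit against the decoded
answer. [Regev 2009, §1] [folklore] -/
theorem s2dAlg_run [NeZero q] (O : Oracle) (S : Fin (m + 1) → (Fin n → ZMod q) × ZMod q) (r : List Bool)
    {k : ℕ} (hk : 2 ≤ k) :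
    s2dAlg.run O k (boolPair (encodeLWESamples S) r) =
      some (decide ((S 0).2 = (S 0).1 ⬝ᵥ decodeSecret n q (O (encodeLWESamples (Fin.tail S))))) := by
  obtain ⟨k, rfl⟩ := Nat.exists_eq_add_of_le' hk
  have h1 : s2dAlg.step (boolPair (encodeLWESamples S) r) [] = Sum.inl (encodeLWESamples (Fin.tail S)) := by
    change s2dDecode (s2dFn (stepArg S r [])) = _
    rw [s2dFn_stepArg_nil]
    rfl
  have h2 : s2dAlg.step (boolPair (encodeLWESamples S) r) [O (encodeLWESamples (Fin.tail S))] =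
      Sum.inr (decide ((S 0).2 = (S 0).1 ⬝ᵥ decodeSecret n q (O (encodeLWESamples (Fin.tail S))))) := by
    change s2dDecode (s2dFn (stepArg S r [O (encodeLWESamples (Fin.tail S))])) = _
    rw [s2dFn_stepArg_cons]
    rfl
  rw [OracleAlg.run, show k + 2 = (k + 1) + 1 from rfl, OracleAlg.runAux_succ, h1]
  simp only [List.nil_append]
  rw [OracleAlg.runAux_succ, h2]

/-- **The distinguisher presented by `M` with oracle `O`** (no coins, two rounds) is the Dirac
kernel of the zero-residual test against the solver `t ↦ decodeSecret n q (O (encodeLWESamples t))`.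
[Regev 2009, §1] [folklore] -/
theorem oracleLWEDistinguisher_s2dAlg [NeZero q] (O : Oracle) (n m : ℕ)
    (S : Fin (m + 1) → (Fin n → ZMod q) × ZMod q) :
    oracleLWEDistinguisher s2dAlg O 0 (Polynomial.C 2) n q (m + 1) S =
      PMF.pure (decide ((S 0).2 = (S 0).1 ⬝ᵥ decodeSecret n q (O (encodeLWESamples (Fin.tail S))))) := by
  rw [oracleLWEDistinguisher, OracleAlg.randRun]
  have h : (fun rv : List.Vector Bool ((0 : Polynomial ℕ).eval (encodeLWESamples S).length) =>
      s2dAlg.run O ((Polynomial.C 2 : Polynomial ℕ).eval (encodeLWESamples S).length)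
        (boolPair (encodeLWESamples S) rv.toList)) =
      Function.const _ (some (decide ((S 0).2 = (S 0).1 ⬝ᵥ
        decodeSecret n q (O (encodeLWESamples (Fin.tail S)))))) := by
    funext rv
    rw [Polynomial.eval_C]
    exact s2dAlg_run O S rv.toList le_rfl
  rw [h, PMF.map_const, PMF.pure_map]
  rfl

end Algorithm

end S2D

end Literature.Computability.Cryptography

end
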